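import Literature.NumberTheory.LFunctions.MatomakiRadziwillTaoMajorArc
import Literature.NumberTheory.Sieve.MoebiusShiftedPrimesMinorArc
import Mathlib.NumberTheory.DiophantineApproximation.Basic
import HarnessLib

/-!
# Matomäki–Radziwiłł–Tao 2015, Proposition 2.4 (discrete form, from Theorem A.2)

K. Matomäki, M. Radziwiłł, T. Tao, *An averaged form of Chowla's conjecture*, Algebra & Number
Theory **9** (2015) 2167–2196 (arXiv:1503.05121), §2, Proposition 2.4 ("completely multiplicative
exponential sum estimate") and the two sentences following the proof of Theorem 2.3 from it
("from the Dirichlet approximation theorem … In the next two sections, we will apply separate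
arguments … in the minor arc case `q > W` and the major arc case `q ≤ W`"), together with the
Ramaré step (3-2)–(3-3) opening §3.  Everything in this file is PROVED from the named fact
`Literature.NumberTheory.LFunctions.MatomakiRadziwillTao2015_theoremA2` (Theorem A.2), through

* the major arc estimate `MRT2015.majorArc_le` (`MatomakiRadziwillTaoMajorArc.lean`, from Theorem A.2),
* the minor arc bilinear estimate `MRT2015.minorArc_bilinear_le` (`MatomakiRadziwillTaoMinorArc.lean`,
  unconditional, `L²` version), and
* the Ramaré decomposition of a restricted window sum, reused from the tree's formalisation of
  the same step in Lichtman 2020 (`Lichtman2020.norm_twistedSum_sub_ramare_le`,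
  `MoebiusShiftedPrimesMinorArc.lean`; Lichtman's weights `1/(ω(m) + 1_{p ∤ m})` make Ramaré's
  identity exact, the terms with `p ∣ m` being the error).

Main statement: `MRT2015.prop24_discrete` — for `g` completely multiplicative and `1`-bounded with
`M(g; X, W) ≥ 3 log W`, a scale `1 ≤ d < W`, heights `X ≤ X₃ ≤ 2X` and the parameter regime of the
proof of Theorem 1.7 (`W ≤ log^{1/125} X`, `W^{203} ≤ L`, `L W^{15} ≤ X`, `L ≤ exp(√(log X / 2))`,
`log⁵ L ≤ W`), uniformly in `α ∈ ℝ`,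
`∑_{x ≤ X₃} |∑_{x < dm ≤ x+L, m ∈ 𝒮'} g(m) e(αm)| ≤ C L X₃ (W⁻² + d⁻¹ W^{-1/4} + (1 + log L)/√(dW))`,
`𝒮' = 𝒮_{W^{200}, L/W³, √X₃, X₃/d}` (`MRT2015.typFun`).  The third term is the minor arc
contribution in the `L²` form of the tree (the printed Hölder-`4` argument gives `d^{-3/4} W^{-1/4}
(log H)^{1/4}`); it is equally sufficient for Theorem 1.7 (see `MatomakiRadziwillTaoKeyEstimate.lean`).

## References
* [MRT2015] Matomäki–Radziwiłł–Tao, Algebra & Number Theory 9 (2015): Proposition 2.4, the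
  Dirichlet-approximation paragraph closing §2, and (3-2)–(3-3).
  [cite: MatomakiRadziwillTao2015, Proposition 2.4]
* J. D. Lichtman, *Averages of the Möbius function on shifted primes*, arXiv:2009.08969, (3.2)–(3.3)
  (the exact form of Ramaré's identity used here).

## Design choices
* Discrete throughout (integer `x`, windows `x < dm ≤ x + L`), as in the major/minor arc files; the
  size constraint `dm ≤ ⌊X₃⌋` carried by `𝒮'` is absorbed into the window length `min(L, ⌊X₃⌋ - x)`,
  which turns Lichtman's divided windows `windowDiv (dp) · (x+1)` into the window indicator
  `MRT2015.WinInd d L ⌊X₃⌋ x (mp)` of the minor arc file.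
* `𝒮'` of §3 (typical factorisation from the second interval on) is `MRT2015.IsTypical₂`.
* Constants are explicit but not optimised.
-/

noncomputable section

open Finset Real
open scoped Classical FourierTransform

namespace Literature.NumberTheory.LFunctions

namespace MRT2015

open Literature.NumberTheory.Sieve (twistedSum)
open Literature.NumberTheory.Sieve.Lichtman2020 (windowDiv mem_windowDiv sum_card_windowDiv_le
  norm_twistedSum_sub_ramare_le norm_ramareCoeff_le)

/-! ### Windows: scale-`d` windows, Lichtman's divided windows, and the window indicator -/

/-- The scale-`d` window `x/d < m ≤ (x+L)/d` (integer division) is the divided window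
`windowDiv d L (x+1) = {m : x + 1 ≤ md ≤ x + L}`. [folklore] -/
theorem Ioc_div_eq_windowDiv {d : ℕ} (hd : 0 < d) (x L : ℕ) :
    Ioc (x / d) ((x + L) / d) = windowDiv d L (x + 1) := by
  ext m
  rw [Finset.mem_Ioc, mem_windowDiv (Nat.succ_le_succ (Nat.zero_le x)),
    Nat.div_lt_iff_lt_mul hd, Nat.le_div_iff_mul_le hd]
  omega

/-- Divided windows increase with the length. [folklore] -/
theorem windowDiv_mono {e H H' k : ℕ} (hk : 1 ≤ k) (h : H' ≤ H) :
    windowDiv e H' k ⊆ windowDiv e H k := by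
  intro m hm
  rw [mem_windowDiv hk] at hm ⊢
  omega

/-- For `x ≤ N`, the `m ∈ [1, N]` with `x < d(mp) ≤ x + L`, `d(mp) ≤ N` form the divided window
`windowDiv (dp) (min(L, N - x)) (x+1)`. [folklore] -/
theorem filter_winInd_mul_eq_windowDiv {d L N x p : ℕ} (hd : 0 < d) (hp : 0 < p) (hx : x ≤ N) :
    (Icc 1 N).filter (fun m => WinInd d L N x (m * p)) =
      windowDiv (d * p) (min L (N - x)) (x + 1) := by
  ext m
  rw [Finset.mem_filter, Finset.mem_Icc, mem_windowDiv (by omega)]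
  unfold WinInd
  have e1 : d * (m * p) = m * (d * p) := by ring
  rw [e1]
  have hm : m ≤ m * (d * p) := Nat.le_mul_of_pos_right m (Nat.mul_pos hd hp)
  have hm0 : m * (d * p) = 0 ∨ 1 ≤ m := by
    rcases Nat.eq_zero_or_pos m with h | h
    · left; rw [h, zero_mul]
    · right; exact h
  generalize m * (d * p) = t at hm hm0 ⊢
  rcases le_total L (N - x) with h | h
  · rw [min_eq_left h]; omega
  · rw [min_eq_right h]; omega

/-- The typical-restricted window sum at scale `d` (the summand of `majorArc_le`) as a filtered
twisted sum over a divided window, the size constraint `dm ≤ ⌊X₃⌋` of `𝒮'` being absorbed into the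
window length `min(L, ⌊X₃⌋ - x)`. [folklore] -/
theorem sum_Ioc_typFun_eq_twistedSum (g : ℕ → ℂ) (P₁ Q₁ X₀ X₃ : ℝ) {d : ℕ} (hd : 0 < d)
    (L : ℕ) {x : ℕ} (hx : x ≤ ⌊X₃⌋₊) (α : ℝ) :
    ∑ m ∈ Ioc (x / d) ((x + L) / d), typFun g P₁ Q₁ X₀ (X₃ / d) m * (𝐞 (α * m) : ℂ) =
      twistedSum g ((windowDiv d (min L (⌊X₃⌋₊ - x)) (x + 1)).filter
        (fun n => n ≠ 0 ∧ IsTypical P₁ Q₁ X₀ n)) α := by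
  have hset : (Ioc (x / d) ((x + L) / d)).filter (fun m => m ∈ typicalSet P₁ Q₁ X₀ (X₃ / d)) =
      (windowDiv d (min L (⌊X₃⌋₊ - x)) (x + 1)).filter
        (fun n => n ≠ 0 ∧ IsTypical P₁ Q₁ X₀ n) := by
    ext m
    rw [Finset.mem_filter, Finset.mem_filter, Finset.mem_Ioc, mem_typicalSet,
      mem_windowDiv (by omega), Nat.div_lt_iff_lt_mul hd, Nat.le_div_iff_mul_le hd,
      Nat.floor_div_natCast, Nat.le_div_iff_mul_le hd]
    have hm : m ≤ m * d := Nat.le_mul_of_pos_right m hd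
    generalize m * d = t at hm ⊢
    constructor
    · rintro ⟨⟨h1, h2⟩, ⟨h3, h4⟩, h5⟩
      refine ⟨?_, by omega, h5⟩
      rcases le_total L (⌊X₃⌋₊ - x) with h | h
      · rw [min_eq_left h]; omega
      · rw [min_eq_right h]; omega
    · rintro ⟨h1, h2, h3⟩
      rcases le_total L (⌊X₃⌋₊ - x) with h | h
      · rw [min_eq_left h] at h1
        exact ⟨⟨by omega, by omega⟩, ⟨by omega, by omega⟩, h3⟩
      · rw [min_eq_right h] at h1
        exact ⟨⟨by omega, by omega⟩, ⟨by omega, by omega⟩, h3⟩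
  unfold twistedSum
  calc ∑ m ∈ Ioc (x / d) ((x + L) / d), typFun g P₁ Q₁ X₀ (X₃ / d) m * (𝐞 (α * m) : ℂ)
      = ∑ m ∈ (Ioc (x / d) ((x + L) / d)).filter (fun m => m ∈ typicalSet P₁ Q₁ X₀ (X₃ / d)),
          g m * (𝐞 (α * m) : ℂ) := by
        rw [Finset.sum_filter]
        refine Finset.sum_congr rfl fun m _ => ?_
        unfold typFun
        split_ifs <;> simp
    _ = ∑ m ∈ (windowDiv d (min L (⌊X₃⌋₊ - x)) (x + 1)).filter
          (fun n => n ≠ 0 ∧ IsTypical P₁ Q₁ X₀ n), g m * (𝐞 ((m : ℝ) * α) : ℂ) := by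
        rw [hset]
        refine Finset.sum_congr rfl fun m _ => by rw [mul_comm α]

/-! ### Typical factorisation from the second interval on (`𝒮'` of §3) -/

/-- `𝒮'` of [MRT2015, §3]: `n` has a prime factor in `[P_j, Q_j]` for every `j ≥ 2` with
`Q_j ≤ exp(√(log X₀))`. [cite: MatomakiRadziwillTao2015, §3 (the set 𝒮')] -/
def IsTypical₂ (P₁ Q₁ X₀ : ℝ) (n : ℕ) : Prop :=
  ∀ j : ℕ, 2 ≤ j → seqQ Q₁ j ≤ Real.exp (Real.sqrt (Real.log X₀)) →
    HasFactorIn n (seqP P₁ Q₁ j) (seqQ Q₁ j)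

/-- `𝒮 = {n : n has a prime factor in [P₁, Q₁]} ∩ 𝒮'` (when the first interval is active).
[cite: MatomakiRadziwillTao2015, §3] -/
theorem isTypical_iff {P₁ Q₁ X₀ : ℝ} (n : ℕ) :
    IsTypical P₁ Q₁ X₀ n ↔
      (Q₁ ≤ Real.exp (Real.sqrt (Real.log X₀)) → HasFactorIn n P₁ Q₁) ∧ IsTypical₂ P₁ Q₁ X₀ n := by
  constructor
  · intro h
    refine ⟨fun h1 => ?_, fun j hj hQ => h j (by omega) hQ⟩
    have := h 1 le_rfl (by rwa [seqQ_one])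
    rwa [seqP_one, seqQ_one] at this
  · rintro ⟨h1, h2⟩ j hj hQ
    rcases Nat.lt_or_ge j 2 with hj2 | hj2
    · obtain rfl : j = 1 := by omega
      rw [seqP_one, seqQ_one]
      rw [seqQ_one] at hQ
      exact h1 hQ
    · exact h2 j hj2 hQ

/-- For `j ≥ 2` one has `Q₁ < P_j` as soon as `log P₁, log Q₁ ≥ 1`
(`log P_j = j^{4j} (log Q₁)^{j-1} log P₁ ≥ 2 log Q₁`). [cite: MatomakiRadziwillTao2015, Definition 2.1] -/
theorem lt_seqP_of_two_le {P₁ Q₁ : ℝ} (hP : 1 ≤ Real.log P₁) (hQ0 : 0 < Q₁) (hQ : 1 ≤ Real.log Q₁)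
    {j : ℕ} (hj : 2 ≤ j) : Q₁ < seqP P₁ Q₁ j := by
  rw [seqP_of_two_le hj]
  conv_lhs => rw [← Real.exp_log hQ0]
  rw [Real.exp_lt_exp]
  have h1 : (2 : ℝ) ≤ (j : ℝ) ^ (4 * j) := by
    have hj2 : (2 : ℝ) ≤ j := by exact_mod_cast hj
    calc (2 : ℝ) = 2 ^ 1 := by norm_num
      _ ≤ 2 ^ (4 * j) := pow_le_pow_right₀ (by norm_num) (by omega)
      _ ≤ (j : ℝ) ^ (4 * j) := pow_le_pow_left₀ (by norm_num) hj2 _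
  have h2 : Real.log Q₁ ≤ Real.log Q₁ ^ (j - 1) := le_self_pow₀ hQ (by omega)
  have h3 : 0 ≤ Real.log Q₁ := by linarith
  calc Real.log Q₁ < 2 * Real.log Q₁ * 1 := by linarith
    _ ≤ (j : ℝ) ^ (4 * j) * Real.log Q₁ ^ (j - 1) * Real.log P₁ := by
        apply mul_le_mul _ hP zero_le_one (by positivity)
        exact mul_le_mul h1 h2 h3 (by positivity)

/-- Multiplying by a prime `p ≤ Q₁ (< P_j, j ≥ 2)` does not change membership in `𝒮'`.
[cite: MatomakiRadziwillTao2015, §3] -/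
theorem isTypical₂_mul_prime_iff {P₁ Q₁ X₀ : ℝ} (hP : 1 ≤ Real.log P₁) (hQ0 : 0 < Q₁)
    (hQ : 1 ≤ Real.log Q₁) {p : ℕ} (hp : p.Prime) (hpQ : (p : ℝ) ≤ Q₁) (m : ℕ) :
    IsTypical₂ P₁ Q₁ X₀ (m * p) ↔ IsTypical₂ P₁ Q₁ X₀ m := by
  have key : ∀ j, 2 ≤ j → (HasFactorIn (m * p) (seqP P₁ Q₁ j) (seqQ Q₁ j) ↔
      HasFactorIn m (seqP P₁ Q₁ j) (seqQ Q₁ j)) := by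
    intro j hj
    rw [mul_comm m p]
    refine hasFactorIn_mul_iff fun r hr hrp => ?_
    have : r = p := (Nat.prime_dvd_prime_iff_eq hr hp).mp hrp
    rw [this]
    exact hpQ.trans_lt (lt_seqP_of_two_le hP hQ0 hQ hj)
  constructor
  · intro h j hj hQj
    exact (key j hj).mp (h j hj hQj)
  · intro h j hj hQj
    exact (key j hj).mpr (h j hj hQj)

/-! ### The Ramaré step ((3-2)–(3-3)) for one window -/

/-- The Ramaré coefficient `c(m) = 1_{𝒮'}(m) g(m) / (ω_𝒫(m) + 1)` of [MRT2015, §3] (with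
`ω_𝒫(m) = #{q ∈ 𝒫 : q ∣ m}`, `𝒫` the primes of `[P₁, Q₁]`). [cite: MatomakiRadziwillTao2015, §3] -/
def ramareCoeff (g : ℕ → ℂ) (P₁ Q₁ X₀ : ℝ) (m : ℕ) : ℂ :=
  if m ≠ 0 ∧ IsTypical₂ P₁ Q₁ X₀ m then
    g m / ((#((primesIcc P₁ Q₁).filter (· ∣ m)) : ℂ) + 1) else 0

/-- `|c(m)| ≤ 1`. [folklore] -/
theorem norm_ramareCoeff_le' {g : ℕ → ℂ} (hg : ∀ n, ‖g n‖ ≤ 1) (P₁ Q₁ X₀ : ℝ) (m : ℕ) :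
    ‖ramareCoeff g P₁ Q₁ X₀ m‖ ≤ 1 := by
  unfold ramareCoeff
  exact norm_ramareCoeff_le (primesIcc P₁ Q₁) (fun m => m ≠ 0 ∧ IsTypical₂ P₁ Q₁ X₀ m) g hg m

/-- **Ramaré's identity applied to one restricted window** ([MRT2015, (3-2)–(3-3)], in Lichtman's
exact form): for `g` completely multiplicative and `1`-bounded, `𝒫` the primes of `[P₁, Q₁]`
(`Q₁ ≤ exp(√(log X₀))`, so that every `n ∈ 𝒮` has a prime factor in `𝒫`; `log P₁, log Q₁ ≥ 1`),
`|∑_{n ∈ windowDiv d H k ∩ 𝒮} g(n) e(nα) - ∑_{p ∈ 𝒫} ∑_{m ∈ windowDiv (dp) H k} c(m) g(p) e(mpα)|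
≤ 2 ∑_{p ∈ 𝒫} #windowDiv (dp²) H k`. [cite: MatomakiRadziwillTao2015, (3-2)–(3-3)] -/
theorem ramare_window {g : ℕ → ℂ} (hgmul : ∀ m n, g (m * n) = g m * g n) (hg : ∀ n, ‖g n‖ ≤ 1)
    {P₁ Q₁ X₀ : ℝ} (hP : 1 ≤ Real.log P₁) (hQ0 : 0 < Q₁) (hQ : 1 ≤ Real.log Q₁)
    (hQX₀ : Q₁ ≤ Real.exp (Real.sqrt (Real.log X₀))) (d H : ℕ) {k : ℕ} (hk : 1 ≤ k) (α : ℝ) :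
    ‖twistedSum g ((windowDiv d H k).filter (fun n => n ≠ 0 ∧ IsTypical P₁ Q₁ X₀ n)) α -
        ∑ p ∈ primesIcc P₁ Q₁, ∑ m ∈ windowDiv (d * p) H k,
          ramareCoeff g P₁ Q₁ X₀ m * g p * (𝐞 (((m * p : ℕ) : ℝ) * α) : ℂ)‖ ≤
      2 * ∑ p ∈ primesIcc P₁ Q₁, (#(windowDiv (d * p * p) H k) : ℝ) := by
  have hPs : ∀ q ∈ primesIcc P₁ Q₁, q.Prime := fun q hq => ((mem_primesIcc hQ0.le).mp hq).1
  refine norm_twistedSum_sub_ramare_le hk (primesIcc P₁ Q₁) hPs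
    (fun n => n ≠ 0 ∧ IsTypical P₁ Q₁ X₀ n) (fun m => m ≠ 0 ∧ IsTypical₂ P₁ Q₁ X₀ m)
    ?_ ?_ g hgmul hg α (ramareCoeff g P₁ Q₁ X₀) (fun m => rfl)
  · rintro n ⟨hn0, hn⟩
    refine ⟨hn0, ?_⟩
    obtain ⟨p, hp, hpn, hP₁p, hpQ₁⟩ := ((isTypical_iff n).mp hn).1 hQX₀
    exact ⟨p, (mem_primesIcc hQ0.le).mpr ⟨hp, hP₁p, hpQ₁⟩, hpn⟩
  · intro p hp m hm0
    obtain ⟨hpp, hP₁p, hpQ₁⟩ := (mem_primesIcc hQ0.le).mp hp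
    rw [isTypical_iff, isTypical₂_mul_prime_iff hP hQ0 hQ hpp hpQ₁ m]
    constructor
    · rintro ⟨-, -, h2⟩
      exact ⟨hm0, h2⟩
    · rintro ⟨-, h2⟩
      exact ⟨Nat.mul_ne_zero hm0 hpp.ne_zero, fun _ => ⟨p, hpp, dvd_mul_left p m, hP₁p, hpQ₁⟩, h2⟩

/-! ### Small analytic lemmas -/

/-- `∑_{n=a}^{b} 1/n² ≤ 1/(a-1)` for `a ≥ 2` (telescoping `1/n² ≤ 1/(n-1) - 1/n`). [folklore] -/
theorem sum_Icc_inv_sq_le {a : ℕ} (ha : 2 ≤ a) (b : ℕ) :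
    ∑ n ∈ Icc a b, (1 : ℝ) / ((n : ℝ) ^ 2) ≤ 1 / ((a : ℝ) - 1) := by
  have ha2 : (2 : ℝ) ≤ a := by exact_mod_cast ha
  have main : ∀ b : ℕ, a ≤ b →
      ∑ n ∈ Icc a b, (1 : ℝ) / ((n : ℝ) ^ 2) ≤ 1 / ((a : ℝ) - 1) - 1 / (b : ℝ) := by
    intro b hb
    induction b, hb using Nat.le_induction with
    | base =>
        rw [Finset.Icc_self, Finset.sum_singleton]
        have ha0 : (a : ℝ) ≠ 0 := (by linarith : (0 : ℝ) < a).ne'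
        have ha1 : (a : ℝ) - 1 ≠ 0 := (by linarith : (0 : ℝ) < a - 1).ne'
        have e : 1 / ((a : ℝ) - 1) - 1 / (a : ℝ) = 1 / (((a : ℝ) - 1) * a) := by
          field_simp
          ring
        rw [e]
        apply one_div_le_one_div_of_le (by nlinarith)
        nlinarith
    | succ b hb ih =>
        rw [Finset.sum_Icc_succ_top (by omega)]
        have hb1 : (2 : ℝ) ≤ b := le_trans ha2 (by exact_mod_cast hb)
        have hb0 : (b : ℝ) ≠ 0 := (by linarith : (0 : ℝ) < b).ne'
        have hb0' : (b : ℝ) + 1 ≠ 0 := (by linarith : (0 : ℝ) < b + 1).ne'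
        have e : 1 / (b : ℝ) - 1 / ((b + 1 : ℕ) : ℝ) = 1 / ((b : ℝ) * (b + 1)) := by
          push_cast
          field_simp
          ring
        have h2 : (1 : ℝ) / (((b + 1 : ℕ) : ℝ) ^ 2) ≤ 1 / (b : ℝ) - 1 / ((b + 1 : ℕ) : ℝ) := by
          rw [e]
          push_cast
          apply one_div_le_one_div_of_le (by positivity)
          nlinarith
        linarith
  rcases lt_or_ge b a with hba | hab
  · rw [Finset.Icc_eq_empty (by omega), Finset.sum_empty]
    exact div_nonneg zero_le_one (by linarith)
  · have h1 := main b hab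
    have h2 : 0 ≤ 1 / (b : ℝ) := by positivity
    linarith

/-- Re-indexing `x + 1 = k`. [folklore] -/
theorem sum_range_succ_eq_sum_Icc (f : ℕ → ℝ) (N : ℕ) :
    ∑ x ∈ range (N + 1), f (x + 1) = ∑ k ∈ Icc 1 (N + 1), f k := by
  rw [Finset.range_eq_Ico, Finset.sum_Ico_add' f 0 (N + 1) 1, zero_add,
    Finset.Ico_add_one_right_eq_Icc]

/-- `∑_{p ∈ 𝒫} 1/p² ≤ 1/(⌈P₁⌉ - 1)` for the primes `𝒫` of `[P₁, Q₁]`, `P₁ > 1`. [folklore] -/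
theorem sum_primesIcc_inv_sq_le {P₁ Q₁ : ℝ} (hP : 1 < P₁) :
    ∑ p ∈ primesIcc P₁ Q₁, (1 : ℝ) / ((p : ℝ) ^ 2) ≤ 1 / ((⌈P₁⌉₊ : ℝ) - 1) := by
  have ha : 2 ≤ ⌈P₁⌉₊ := Nat.lt_ceil.mpr (by exact_mod_cast hP)
  calc ∑ p ∈ primesIcc P₁ Q₁, (1 : ℝ) / ((p : ℝ) ^ 2)
      ≤ ∑ n ∈ Icc ⌈P₁⌉₊ ⌊Q₁⌋₊, (1 : ℝ) / ((n : ℝ) ^ 2) :=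
        Finset.sum_le_sum_of_subset_of_nonneg (Finset.filter_subset _ _)
          (fun n _ _ => by positivity)
    _ ≤ 1 / ((⌈P₁⌉₊ : ℝ) - 1) := sum_Icc_inv_sq_le ha _

/-! ### The minor arc case: Ramaré, then the bilinear estimate -/

/-- **Minor arc case of Proposition 2.4, before numerics** ([MRT2015, §3]): for `g` completely
multiplicative and `1`-bounded, `|α - a/q| ≤ q⁻²` with `(a, q) = 1`, `2 ≤ P₁`, `log P₁, log Q₁ ≥ 1`,
`Q₁ ≤ exp(√(log X₀))` and `L ≥ 1`, with `N = ⌊X₃⌋` and `Φ = minorArcPhi d L q P₁ Q₁`,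
`∑_{x ≤ N} |∑_{x < dm ≤ x+L, m ∈ 𝒮_{P₁,Q₁,X₀,X₃/d}} g(m) e(αm)|
  ≤ 10 (N+1) √(L Φ (log₂ Q₁ + 1)/d) + 2 L (N + 1 + L)/(d (⌈P₁⌉ - 1))`:
the Ramaré step `ramare_window` in every window, the bilinear estimate `minorArc_bilinear_le` for
the main terms, and the pair count `sum_card_windowDiv_le` with `∑_{p ≥ P₁} p⁻² ≤ 1/(⌈P₁⌉-1)` for the
terms with `p ∣ m`. [cite: MatomakiRadziwillTao2015, §3] -/
theorem minorArc_typ_le {g : ℕ → ℂ} (hgmul : ∀ m n, g (m * n) = g m * g n) (hg : ∀ n, ‖g n‖ ≤ 1)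
    {P₁ Q₁ X₀ X₃ : ℝ} (hP2 : 2 ≤ P₁) (hP : 1 ≤ Real.log P₁) (hQ0 : 0 < Q₁) (hQ : 1 ≤ Real.log Q₁)
    (hQX₀ : Q₁ ≤ Real.exp (Real.sqrt (Real.log X₀))) {d L : ℕ} (hd : 0 < d) (hL : 1 ≤ L)
    {α : ℝ} {a : ℤ} {q : ℕ} (hq : 1 ≤ q) (hcop : IsCoprime a q)
    (hα : |α - a / q| ≤ 1 / (q : ℝ) ^ 2) :
    ∑ x ∈ range (⌊X₃⌋₊ + 1), ‖∑ m ∈ Ioc (x / d) ((x + L) / d),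
        typFun g P₁ Q₁ X₀ (X₃ / d) m * (𝐞 (α * m) : ℂ)‖ ≤
      10 * ((⌊X₃⌋₊ : ℝ) + 1) *
          Real.sqrt (L * minorArcPhi d L q P₁ Q₁ * (Nat.log 2 ⌊Q₁⌋₊ + 1) / d) +
        2 * ((L : ℝ) * (((⌊X₃⌋₊ + 1 : ℕ) : ℝ) + L) / d) * (1 / ((⌈P₁⌉₊ : ℝ) - 1)) := by
  set N := ⌊X₃⌋₊ with hN
  set Ps := primesIcc P₁ Q₁ with hPs
  have hPsmem : ∀ p ∈ Ps, p.Prime ∧ P₁ ≤ p ∧ (p : ℝ) ≤ Q₁ :=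
    fun p hp => (mem_primesIcc hQ0.le).mp hp
  have hd1 : (1 : ℝ) ≤ d := by exact_mod_cast hd
  -- the main terms and the errors
  set main : ℕ → ℂ := fun x => ∑ p ∈ Ps, ∑ m ∈ Icc 1 N, ramareCoeff g P₁ Q₁ X₀ m * g p *
      (𝐞 (α * ((m : ℝ) * p)) : ℂ) * (if WinInd d L N x (m * p) then 1 else 0) with hmain
  set err : ℕ → ℝ := fun x =>
    2 * ∑ p ∈ Ps, (#(windowDiv (d * p * p) (min L (N - x)) (x + 1)) : ℝ) with herr
  -- Step 1: in every window, `‖T_x‖ ≤ ‖main_x‖ + err_x`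
  have hterm : ∀ x ∈ range (N + 1), ‖∑ m ∈ Ioc (x / d) ((x + L) / d),
      typFun g P₁ Q₁ X₀ (X₃ / d) m * (𝐞 (α * m) : ℂ)‖ ≤ ‖main x‖ + err x := by
    intro x hx
    have hxN : x ≤ N := Nat.lt_succ_iff.mp (Finset.mem_range.mp hx)
    rw [sum_Ioc_typFun_eq_twistedSum g P₁ Q₁ X₀ X₃ hd L hxN α]
    have hR := ramare_window hgmul hg hP hQ0 hQ hQX₀ d (min L (N - x)) (k := x + 1) (by omega) α
    have hmain_eq : main x = ∑ p ∈ Ps, ∑ m ∈ windowDiv (d * p) (min L (N - x)) (x + 1),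
        ramareCoeff g P₁ Q₁ X₀ m * g p * (𝐞 (((m * p : ℕ) : ℝ) * α) : ℂ) := by
      rw [hmain]
      refine Finset.sum_congr rfl fun p hp => ?_
      have hp0 : 0 < p := (hPsmem p hp).1.pos
      rw [← filter_winInd_mul_eq_windowDiv hd hp0 hxN, Finset.sum_filter]
      refine Finset.sum_congr rfl fun m _ => ?_
      have e : (((m * p : ℕ) : ℝ) * α) = α * ((m : ℝ) * p) := by push_cast; ring
      rw [e]
      split_ifs <;> simp
    rw [hmain_eq]
    calc _ ≤ _ := norm_le_insert' _ _
      _ ≤ _ := by rw [herr]; linarith [hR]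
  -- Step 2: the main terms, by the bilinear estimate
  have hA : ∑ x ∈ range (N + 1), ‖main x‖ ≤ 10 * ((N : ℝ) + 1) *
      Real.sqrt (L * minorArcPhi d L q P₁ Q₁ * (Nat.log 2 ⌊Q₁⌋₊ + 1) / d) := by
    have h := minorArc_bilinear_le (d := d) (L := L) (N := N) hd hP2 Ps hPsmem
      (ramareCoeff g P₁ Q₁ X₀) (fun p => g p) (norm_ramareCoeff_le' hg P₁ Q₁ X₀)
      (fun p => hg p) hq hcop hα
    rw [hmain]
    exact h
  -- Step 3: the error terms
  have hB : ∑ x ∈ range (N + 1), err x ≤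
      2 * ((L : ℝ) * (((N + 1 : ℕ) : ℝ) + L) / d) * (1 / ((⌈P₁⌉₊ : ℝ) - 1)) := by
    have h1 : ∀ x ∈ range (N + 1), err x ≤
        2 * ∑ p ∈ Ps, (#(windowDiv (d * p * p) L (x + 1)) : ℝ) := by
      intro x _
      rw [herr]
      refine mul_le_mul_of_nonneg_left (Finset.sum_le_sum fun p _ => ?_) (by norm_num)
      exact_mod_cast Finset.card_le_card (windowDiv_mono (by omega) (min_le_left _ _))
    refine (Finset.sum_le_sum h1).trans ?_
    rw [← Finset.mul_sum, Finset.sum_comm]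
    have h2 : ∀ p ∈ Ps, ∑ x ∈ range (N + 1), (#(windowDiv (d * p * p) L (x + 1)) : ℝ) ≤
        (L : ℝ) * (((N + 1 : ℕ) : ℝ) + L) / d * (1 / ((p : ℝ) ^ 2)) := by
      intro p hp
      have hp0 : 0 < p := (hPsmem p hp).1.pos
      have hdpp : 1 ≤ d * p * p := Nat.mul_pos (Nat.mul_pos hd hp0) hp0
      rw [sum_range_succ_eq_sum_Icc (fun k => (#(windowDiv (d * p * p) L k) : ℝ)) N]
      refine (sum_card_windowDiv_le (N + 1) L (d * p * p) hdpp hL).trans (le_of_eq ?_)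
      have hp0' : (p : ℝ) ≠ 0 := by exact_mod_cast hp0.ne'
      have hd0' : (d : ℝ) ≠ 0 := by exact_mod_cast hd.ne'
      push_cast
      field_simp
    calc 2 * ∑ p ∈ Ps, ∑ x ∈ range (N + 1), (#(windowDiv (d * p * p) L (x + 1)) : ℝ)
        ≤ 2 * ∑ p ∈ Ps, (L : ℝ) * (((N + 1 : ℕ) : ℝ) + L) / d * (1 / ((p : ℝ) ^ 2)) :=
          mul_le_mul_of_nonneg_left (Finset.sum_le_sum h2) (by norm_num)
      _ = 2 * ((L : ℝ) * (((N + 1 : ℕ) : ℝ) + L) / d) * ∑ p ∈ Ps, (1 / ((p : ℝ) ^ 2)) := by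
          rw [← Finset.mul_sum]; ring
      _ ≤ 2 * ((L : ℝ) * (((N + 1 : ℕ) : ℝ) + L) / d) * (1 / ((⌈P₁⌉₊ : ℝ) - 1)) := by
          refine mul_le_mul_of_nonneg_left (sum_primesIcc_inv_sq_le (by linarith)) ?_
          positivity
  -- Summation
  calc ∑ x ∈ range (N + 1), ‖∑ m ∈ Ioc (x / d) ((x + L) / d),
        typFun g P₁ Q₁ X₀ (X₃ / d) m * (𝐞 (α * m) : ℂ)‖
      ≤ ∑ x ∈ range (N + 1), (‖main x‖ + err x) := Finset.sum_le_sum hterm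
    _ = ∑ x ∈ range (N + 1), ‖main x‖ + ∑ x ∈ range (N + 1), err x := Finset.sum_add_distrib
    _ ≤ _ := add_le_add hA hB

/-! ### Numerics of the minor arc case in the regime of Theorem 1.7 -/

/-- `log₂ n ≤ 2 log n` (`Nat.log` versus `Real.log`; both sides vanish at `n = 0, 1`). [folklore] -/
theorem natLog_two_le_two_mul_log (n : ℕ) : (Nat.log 2 n : ℝ) ≤ 2 * Real.log n := by
  rcases Nat.eq_zero_or_pos n with rfl | hn
  · simp
  have h1 : ((2 ^ Nat.log 2 n : ℕ) : ℝ) ≤ n := by exact_mod_cast Nat.pow_log_le_self 2 hn.ne'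
  have h2 : (Nat.log 2 n : ℝ) * Real.log 2 ≤ Real.log n := by
    rw [← Real.log_pow]
    exact Real.log_le_log (by positivity) (by exact_mod_cast h1)
  have h3 : (1 / 2 : ℝ) < Real.log 2 := by
    have := Real.log_two_gt_d9; linarith
  have h4 : 0 ≤ (Nat.log 2 n : ℝ) := Nat.cast_nonneg _
  nlinarith

/-- In the regime `W < q ≤ L/W`, `log⁵ L ≤ W`, `W^{203} ≤ L`, `3 ≤ W`:
`Φ = minorArcPhi d L q W^{200} (L/W³) ≤ 47 L (1 + log L)/W`. [cite: MatomakiRadziwillTao2015, §3 (final display)] -/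
theorem minorArcPhi_le {W : ℝ} {L d q : ℕ} (hW : 3 ≤ W) (hd : 1 ≤ d) (hWq : W < q)
    (hqL : (q : ℝ) ≤ L / W) (hWL : W ^ 203 ≤ (L : ℝ)) :
    minorArcPhi d L q (W ^ 200) (L / W ^ 3) ≤ 47 * L * (1 + Real.log L) / W := by
  have hW0 : 0 < W := by linarith
  have hW1 : 1 ≤ W := by linarith
  have hq0 : (0 : ℝ) < q := hW0.trans hWq
  have hd1 : (1 : ℝ) ≤ d := by exact_mod_cast hd
  have hLW : W ≤ (L : ℝ) := le_trans (le_self_pow₀ hW1 (by norm_num)) hWL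
  have hL0 : (0 : ℝ) < L := hW0.trans_le hLW
  have hqL' : (q : ℝ) ≤ L := hqL.trans (div_le_self hL0.le hW1)
  have hlogL0 : 0 ≤ Real.log L := Real.log_nonneg (hW1.trans hLW)
  set ℓ := 1 + Real.log L with hℓ
  have hℓ1 : 1 ≤ ℓ := by rw [hℓ]; linarith
  have hlogq : 1 + Real.log q ≤ ℓ := by
    rw [hℓ]; linarith [Real.log_le_log hq0 hqL']
  have hlogq0 : 0 ≤ 1 + Real.log q := by
    have := Real.log_nonneg (show (1 : ℝ) ≤ q by exact_mod_cast (Nat.one_le_cast.mp (by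
      have : (1 : ℝ) ≤ q := by linarith
      exact_mod_cast this)))
    linarith
  -- the six terms
  have hLW' : L / W ≤ L * ℓ / W := by
    rw [div_le_div_iff_of_pos_right hW0]
    nlinarith
  have T1 : 10 * (L : ℝ) / (d * q) ≤ 10 * (L * ℓ / W) := by
    have h1 : 10 * (L : ℝ) / (d * q) ≤ 10 * (L / W) := by
      rw [mul_div_assoc]
      refine mul_le_mul_of_nonneg_left ?_ (by norm_num)
      exact div_le_div_of_nonneg_left hL0.le hW0 (by nlinarith)
    linarith [mul_le_mul_of_nonneg_left hLW' (by norm_num : (0 : ℝ) ≤ 10)]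
  have hQ₁ : (L : ℝ) / W ^ 3 ≤ L / W := by
    refine div_le_div_of_nonneg_left hL0.le hW0 ?_
    calc W = W ^ 1 := (pow_one W).symm
      _ ≤ W ^ 3 := pow_le_pow_right₀ hW1 (by norm_num)
  have hQ₁0 : 0 ≤ (L : ℝ) / W ^ 3 := by positivity
  have T2 : 10 * ((L : ℝ) / W ^ 3) / q ≤ 10 * (L * ℓ / W) := by
    have h1 : ((L : ℝ) / W ^ 3) / q ≤ (L / W ^ 3) / 1 := by
      exact div_le_div_of_nonneg_left hQ₁0 one_pos (by linarith)
    rw [div_one] at h1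
    have : 10 * ((L : ℝ) / W ^ 3) / q = 10 * (((L : ℝ) / W ^ 3) / q) := by ring
    rw [this]
    linarith
  have T3 : 8 * ((L : ℝ) / W ^ 3) * (1 + Real.log q) ≤ 8 * (L * ℓ / W) := by
    calc 8 * ((L : ℝ) / W ^ 3) * (1 + Real.log q) ≤ 8 * (L / W) * ℓ := by
          apply mul_le_mul (mul_le_mul_of_nonneg_left hQ₁ (by norm_num)) hlogq hlogq0
          positivity
      _ = 8 * (L * ℓ / W) := by ring
  have T4 : 10 * (L : ℝ) / (d * W ^ 200) ≤ 10 * (L * ℓ / W) := by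
    have h1 : 10 * (L : ℝ) / (d * W ^ 200) ≤ 10 * (L / W) := by
      rw [mul_div_assoc]
      refine mul_le_mul_of_nonneg_left ?_ (by norm_num)
      refine div_le_div_of_nonneg_left hL0.le hW0 ?_
      calc W = 1 * W ^ 1 := by ring
        _ ≤ d * W ^ 200 := mul_le_mul hd1 (pow_le_pow_right₀ hW1 (by norm_num)) (by positivity)
            (by positivity)
    linarith [mul_le_mul_of_nonneg_left hLW' (by norm_num : (0 : ℝ) ≤ 10)]
  have T5 : (5 : ℝ) ≤ 5 * (L * ℓ / W) := by
    have h1 : (1 : ℝ) ≤ L / W := by rw [le_div_iff₀ hW0, one_mul]; exact hLW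
    linarith
  have T6 : 4 * (q : ℝ) * (1 + Real.log q) ≤ 4 * (L * ℓ / W) := by
    calc 4 * (q : ℝ) * (1 + Real.log q) ≤ 4 * (L / W) * ℓ := by
          apply mul_le_mul (mul_le_mul_of_nonneg_left hqL (by norm_num)) hlogq hlogq0
          positivity
      _ = 4 * (L * ℓ / W) := by ring
  unfold minorArcPhi
  have e : 47 * (L : ℝ) * (1 + Real.log L) / W = 47 * (L * ℓ / W) := by rw [hℓ]; ring
  rw [e]
  linarith

/-- **Numerics of the minor arc case**: in the regime of Theorem 1.7 the bound of
`minorArc_typ_le` is at most `212 L X₃ ((1 + log L)/√(dW) + W⁻²)`. [cite: MatomakiRadziwillTao2015, §3] -/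
theorem minorArc_numerics {W X₃ : ℝ} {L d q : ℕ} (hW : 3 ≤ W) (hd : 1 ≤ d) (hWq : W < q)
    (hqL : (q : ℝ) ≤ L / W) (hWL : W ^ 203 ≤ (L : ℝ)) (hX₃ : 1 ≤ X₃) (hLX : (L : ℝ) ≤ X₃) :
    10 * ((⌊X₃⌋₊ : ℝ) + 1) *
          Real.sqrt (L * minorArcPhi d L q (W ^ 200) (L / W ^ 3) * (Nat.log 2 ⌊L / W ^ 3⌋₊ + 1) / d) +
        2 * ((L : ℝ) * (((⌊X₃⌋₊ + 1 : ℕ) : ℝ) + L) / d) * (1 / ((⌈W ^ 200⌉₊ : ℝ) - 1)) ≤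
      212 * L * X₃ * ((1 + Real.log L) / Real.sqrt (d * W) + 1 / W ^ 2) := by
  have hW0 : 0 < W := by linarith
  have hW1 : 1 ≤ W := by linarith
  have hd1 : (1 : ℝ) ≤ d := by exact_mod_cast hd
  have hd0 : (0 : ℝ) < d := by linarith
  have hLW : W ≤ (L : ℝ) := le_trans (le_self_pow₀ hW1 (by norm_num)) hWL
  have hL0 : (0 : ℝ) < L := hW0.trans_le hLW
  have hL1 : (1 : ℝ) ≤ L := hW1.trans hLW
  have hlogL0 : 0 ≤ Real.log L := Real.log_nonneg hL1
  set ℓ := 1 + Real.log L with hℓ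
  have hℓ1 : 1 ≤ ℓ := by rw [hℓ]; linarith
  have hX₃0 : 0 < X₃ := by linarith
  have hN : (⌊X₃⌋₊ : ℝ) ≤ X₃ := Nat.floor_le hX₃0.le
  -- Φ and the dyadic count
  have hΦ := minorArcPhi_le hW hd hWq hqL hWL
  have hΦ0 : 0 ≤ minorArcPhi d L q (W ^ 200) (L / W ^ 3) :=
    minorArcPhi_nonneg (by exact_mod_cast (show (1 : ℝ) ≤ q by linarith)) (by positivity)
      (by positivity)
  have hlog2 : ((Nat.log 2 ⌊(L : ℝ) / W ^ 3⌋₊ : ℕ) : ℝ) + 1 ≤ 2 * ℓ := by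
    have h1 := natLog_two_le_two_mul_log ⌊(L : ℝ) / W ^ 3⌋₊
    rcases Nat.eq_zero_or_pos ⌊(L : ℝ) / W ^ 3⌋₊ with h0 | h0
    · rw [h0, Nat.log_zero_right, Nat.cast_zero]; linarith
    · have h2 : Real.log (⌊(L : ℝ) / W ^ 3⌋₊ : ℕ) ≤ Real.log L := by
        refine Real.log_le_log (by exact_mod_cast h0) ?_
        calc ((⌊(L : ℝ) / W ^ 3⌋₊ : ℕ) : ℝ) ≤ L / W ^ 3 := Nat.floor_le (by positivity)
          _ ≤ L := div_le_self hL0.le (one_le_pow₀ hW1)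
      rw [hℓ]; linarith
  -- under the square root
  have hsq : (L : ℝ) * minorArcPhi d L q (W ^ 200) (L / W ^ 3) * (Nat.log 2 ⌊(L : ℝ) / W ^ 3⌋₊ + 1) / d
      ≤ (10 * L * ℓ / Real.sqrt (d * W)) ^ 2 := by
    have hdW : 0 < (d : ℝ) * W := by positivity
    rw [div_pow, Real.sq_sqrt hdW.le]
    rw [div_le_div_iff₀ hd0 hdW]
    have hlog0 : 0 ≤ ((Nat.log 2 ⌊(L : ℝ) / W ^ 3⌋₊ : ℕ) : ℝ) + 1 := by positivity
    calc (L : ℝ) * minorArcPhi d L q (W ^ 200) (L / W ^ 3) * (Nat.log 2 ⌊(L : ℝ) / W ^ 3⌋₊ + 1) * (d * W)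
        ≤ (L : ℝ) * (47 * L * (1 + Real.log L) / W) * (2 * ℓ) * (d * W) := by
          apply mul_le_mul_of_nonneg_right _ hdW.le
          exact mul_le_mul (mul_le_mul_of_nonneg_left hΦ hL0.le) hlog2 hlog0 (by positivity)
      _ = 94 * (L : ℝ) ^ 2 * ℓ ^ 2 * d * (W⁻¹ * W) := by rw [hℓ]; ring
      _ = 94 * (L : ℝ) ^ 2 * ℓ ^ 2 * d := by rw [inv_mul_cancel₀ hW0.ne', mul_one]
      _ ≤ (10 * L * ℓ) ^ 2 * d := by nlinarith [sq_nonneg ((L : ℝ) * ℓ), hd0]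
  have hT : Real.sqrt ((L : ℝ) * minorArcPhi d L q (W ^ 200) (L / W ^ 3) *
      (Nat.log 2 ⌊(L : ℝ) / W ^ 3⌋₊ + 1) / d) ≤ 10 * L * ℓ / Real.sqrt (d * W) := by
    have h0 : 0 ≤ 10 * L * ℓ / Real.sqrt (d * W) := by positivity
    calc _ ≤ Real.sqrt ((10 * L * ℓ / Real.sqrt (d * W)) ^ 2) := Real.sqrt_le_sqrt hsq
      _ = 10 * L * ℓ / Real.sqrt (d * W) := Real.sqrt_sq h0
  -- first term
  have h1 : 10 * ((⌊X₃⌋₊ : ℝ) + 1) * Real.sqrt (L * minorArcPhi d L q (W ^ 200) (L / W ^ 3) *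
      (Nat.log 2 ⌊(L : ℝ) / W ^ 3⌋₊ + 1) / d) ≤ 200 * L * X₃ * (ℓ / Real.sqrt (d * W)) := by
    have hN1 : 10 * ((⌊X₃⌋₊ : ℝ) + 1) ≤ 20 * X₃ := by linarith
    calc 10 * ((⌊X₃⌋₊ : ℝ) + 1) * Real.sqrt (L * minorArcPhi d L q (W ^ 200) (L / W ^ 3) *
          (Nat.log 2 ⌊(L : ℝ) / W ^ 3⌋₊ + 1) / d)
        ≤ 20 * X₃ * (10 * L * ℓ / Real.sqrt (d * W)) :=
          mul_le_mul hN1 hT (Real.sqrt_nonneg _) (by positivity)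
      _ = 200 * L * X₃ * (ℓ / Real.sqrt (d * W)) := by ring
  -- second term
  have h2 : 2 * ((L : ℝ) * (((⌊X₃⌋₊ + 1 : ℕ) : ℝ) + L) / d) * (1 / ((⌈W ^ 200⌉₊ : ℝ) - 1)) ≤
      12 * L * X₃ * (1 / W ^ 2) := by
    have hP : W ^ 200 ≤ ((⌈W ^ 200⌉₊ : ℕ) : ℝ) := Nat.le_ceil _
    have hW200 : 2 * W ^ 2 ≤ W ^ 200 - 1 := by
      have h3 : W ^ 2 * 9 ≤ W ^ 200 := by
        calc W ^ 2 * 9 ≤ W ^ 2 * W ^ 2 := by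
              apply mul_le_mul_of_nonneg_left _ (by positivity); nlinarith
          _ = W ^ 4 := by ring
          _ ≤ W ^ 200 := pow_le_pow_right₀ hW1 (by norm_num)
      nlinarith
    have hden : 0 < ((⌈W ^ 200⌉₊ : ℕ) : ℝ) - 1 := by nlinarith
    have h4 : 1 / (((⌈W ^ 200⌉₊ : ℕ) : ℝ) - 1) ≤ 1 / (2 * W ^ 2) :=
      one_div_le_one_div_of_le (by positivity) (by linarith)
    have h5 : (L : ℝ) * (((⌊X₃⌋₊ + 1 : ℕ) : ℝ) + L) / d ≤ L * (3 * X₃) := by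
      rw [div_le_iff₀ hd0]
      push_cast
      have : ((⌊X₃⌋₊ : ℝ) + 1 + L) ≤ 3 * X₃ := by linarith
      calc (L : ℝ) * ((⌊X₃⌋₊ : ℝ) + 1 + L) ≤ L * (3 * X₃) := mul_le_mul_of_nonneg_left this hL0.le
        _ = L * (3 * X₃) * 1 := (mul_one _).symm
        _ ≤ L * (3 * X₃) * d := mul_le_mul_of_nonneg_left hd1 (by positivity)
    calc 2 * ((L : ℝ) * (((⌊X₃⌋₊ + 1 : ℕ) : ℝ) + L) / d) * (1 / ((⌈W ^ 200⌉₊ : ℝ) - 1))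
        ≤ 2 * (L * (3 * X₃)) * (1 / (2 * W ^ 2)) :=
          mul_le_mul (mul_le_mul_of_nonneg_left h5 (by norm_num)) h4 (by positivity) (by positivity)
      _ = 3 * L * X₃ * (1 / W ^ 2) := by ring
      _ ≤ 12 * L * X₃ * (1 / W ^ 2) := by
          have : 0 ≤ L * X₃ * (1 / W ^ 2) := by positivity
          nlinarith
  have hA0 : 0 ≤ ℓ / Real.sqrt (d * W) := by positivity
  have hB0 : 0 ≤ 1 / W ^ 2 := by positivity
  have hLX0 : 0 ≤ (L : ℝ) * X₃ := by positivity
  rw [hℓ] at h1 hA0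
  nlinarith

/-! ### Proposition 2.4, discrete form -/

/-- **[MRT2015, Proposition 2.4] in discrete form (from Theorem A.2).**  There are absolute
`C, W₀, X⁎` such that for `g` completely multiplicative and `1`-bounded, heights `X⁎ ≤ X ≤ X₃ ≤ 2X`,
`W₀ ≤ W ≤ log^{1/125} X`, a scale `1 ≤ d < W`, a window `L` with `W^{203} ≤ L`, `L W^{15} ≤ X`,
`L ≤ exp(√(log X / 2))`, `log⁵ L ≤ W`, and `M(g; X, W) ≥ 3 log W` (hypothesis (2-4)), for every real
`α`,
`∑_{x ≤ X₃} |∑_{x < dm ≤ x + L, m ∈ 𝒮'} g(m) e(αm)| ≤ C L X₃ (W⁻² + d⁻¹ W^{-1/4} + (1 + log L)/√(dW))`,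
`𝒮' = 𝒮_{W^{200}, L/W³, √X₃, X₃/d}`.  Proof as printed: Dirichlet's approximation theorem gives
`a/q`, `(a,q) = 1`, `1 ≤ q ≤ L/W`, `|α - a/q| ≤ W/(qL) ≤ q⁻²`; the case `q ≤ W` is `majorArc_le`,
the case `q > W` is `minorArc_typ_le` with `minorArc_numerics`.
[cite: MatomakiRadziwillTao2015, Proposition 2.4] -/
theorem prop24_discrete (hA2 : MatomakiRadziwillTao2015_theoremA2) :
    ∃ C W₀ Xs : ℝ, 0 < C ∧ ∀ (X X₃ W : ℝ) (L d : ℕ) (α : ℝ) (g : ArithmeticFunction ℂ),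
      (∀ m n : ℕ, g (m * n) = g m * g n) → g 1 = 1 → (∀ n, ‖g n‖ ≤ 1) →
      Xs ≤ X → X ≤ X₃ → X₃ ≤ 2 * X → W₀ ≤ W → W ≤ Real.log X ^ (1 / 125 : ℝ) →
      1 ≤ d → (d : ℝ) < W →
      W ^ 203 ≤ (L : ℝ) → (L : ℝ) * W ^ 15 ≤ X → (L : ℝ) ≤ Real.exp (Real.sqrt (Real.log X / 2)) →
      Real.log L ^ 5 ≤ W → 3 * Real.log W ≤ Sieve.nonpretentiousness g X W →
      ∑ x ∈ range (⌊X₃⌋₊ + 1), ‖∑ m ∈ Ioc (x / d) ((x + L) / d),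
          typFun g (W ^ 200) (L / W ^ 3) (Real.sqrt X₃) (X₃ / d) m * (𝐞 (α * m) : ℂ)‖ ≤
        C * L * X₃ * (1 / W ^ 2 + 1 / (d * W ^ (1 / 4 : ℝ)) +
          (1 + Real.log L) / Real.sqrt (d * W)) := by
  obtain ⟨C₁, W₁, X₁, hC₁, hmaj⟩ := majorArc_le hA2
  refine ⟨C₁ + 212, max W₁ 3, max X₁ 1, by positivity, ?_⟩
  intro X X₃ W L d α g hg hg1' hg1 hXs hXX₃ hX₃ hW₀ hWX hd hdW hWL hLX hLexp hlogL hM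
  -- basics
  have hW₁ : W₁ ≤ W := (le_max_left _ _).trans hW₀
  have hW3 : 3 ≤ W := (le_max_right _ _).trans hW₀
  have hW0 : 0 < W := by linarith
  have hW1 : 1 ≤ W := by linarith
  have hX₁ : X₁ ≤ X := (le_max_left _ _).trans hXs
  have hX1 : 1 ≤ X := (le_max_right _ _).trans hXs
  have hX₃1 : 1 ≤ X₃ := hX1.trans hXX₃
  have hd0 : 0 < d := hd
  have hLW : W ≤ (L : ℝ) := le_trans (le_self_pow₀ hW1 (by norm_num)) hWL
  have hL1 : (1 : ℝ) ≤ L := hW1.trans hLW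
  have hL0 : (0 : ℝ) < L := by linarith
  have hL : 1 ≤ L := by exact_mod_cast hL1
  have hLX' : (L : ℝ) ≤ X := by
    calc (L : ℝ) = L * 1 := (mul_one _).symm
      _ ≤ L * W ^ 15 := mul_le_mul_of_nonneg_left (one_le_pow₀ hW1) hL0.le
      _ ≤ X := hLX
  have hLX₃ : (L : ℝ) ≤ X₃ := hLX'.trans hXX₃
  have hlogL0 : 0 ≤ Real.log L := Real.log_nonneg hL1
  have hextra : 0 ≤ (1 + Real.log L) / Real.sqrt (d * W) := by positivity
  have hA0 : 0 ≤ 1 / W ^ 2 + 1 / ((d : ℝ) * W ^ (1 / 4 : ℝ)) := by positivity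
  have hLX0 : 0 ≤ (L : ℝ) * X₃ := by positivity
  -- Dirichlet's approximation theorem with `Q = L/W`
  set n : ℕ := ⌊(L : ℝ) / W⌋₊ with hn
  have hLW1 : 1 ≤ (L : ℝ) / W := by
    rw [le_div_iff₀ hW0, one_mul]; exact hLW
  have hn1 : 1 ≤ n := Nat.le_floor (by exact_mod_cast hLW1)
  have hnle : (n : ℝ) ≤ L / W := Nat.floor_le (by positivity)
  have hnlt : (L : ℝ) / W < n + 1 := Nat.lt_floor_add_one _
  obtain ⟨r, hr, hden⟩ := Real.exists_rat_abs_sub_le_and_den_le α (by omega : 0 < n)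
  set q : ℕ := r.den with hq
  have hq1 : 1 ≤ q := r.den_pos
  have hq0 : (0 : ℝ) < q := by exact_mod_cast hq1
  have hqn : (q : ℝ) ≤ n := by exact_mod_cast hden
  have hqL : (q : ℝ) ≤ L / W := hqn.trans hnle
  have hrq : ((r.num : ℝ) / (q : ℕ) : ℝ) = (r : ℝ) := by rw [hq, Rat.cast_def]
  have hcop : IsCoprime r.num (q : ℤ) := by
    refine Int.isCoprime_iff_gcd_eq_one.mpr ?_
    show Nat.gcd r.num.natAbs r.den = 1
    exact r.reduced
  have hβ : |α - r.num / q| ≤ W / (q * L) := by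
    rw [hrq]
    refine hr.trans ?_
    rw [div_le_div_iff₀ (by positivity) (by positivity), one_mul]
    have : (L : ℝ) ≤ W * (n + 1) := by
      rw [div_lt_iff₀ hW0] at hnlt; linarith
    nlinarith
  have hα2 : |α - r.num / q| ≤ 1 / (q : ℝ) ^ 2 := by
    rw [hrq]
    refine hr.trans ?_
    rw [sq]
    refine one_div_le_one_div_of_le (by positivity) ?_
    refine mul_le_mul_of_nonneg_right ?_ hq0.le
    linarith
  rcases le_or_gt (q : ℝ) W with hqW | hWq
  · -- major arc
    have h := hmaj X X₃ W L d q r.num α g hg hg1' hg1 hX₁ hXX₃ hX₃ hW₁ hWX hd hdW hq1 hqW hβ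
      hWL hLX hLexp hlogL hM
    refine h.trans ?_
    have h1 : C₁ * L * X₃ * (1 / W ^ 2 + 1 / (d * W ^ (1 / 4 : ℝ))) ≤
        C₁ * L * X₃ * (1 / W ^ 2 + 1 / (d * W ^ (1 / 4 : ℝ)) +
          (1 + Real.log L) / Real.sqrt (d * W)) :=
      mul_le_mul_of_nonneg_left (le_add_of_nonneg_right hextra) (by positivity)
    refine h1.trans ?_
    apply mul_le_mul_of_nonneg_right _ (by positivity)
    apply mul_le_mul_of_nonneg_right _ (by positivity)
    exact mul_le_mul_of_nonneg_right (by linarith) (by positivity)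
  · -- minor arc
    have hP2 : (2 : ℝ) ≤ W ^ 200 := le_trans (by linarith) (le_self_pow₀ hW1 (by norm_num))
    have hlog3 : 1 ≤ Real.log 3 := by
      rw [← Real.log_exp 1]
      refine Real.log_le_log (Real.exp_pos 1) ?_
      have := Real.exp_one_lt_d9; linarith
    have hlogW : 1 ≤ Real.log W := hlog3.trans (Real.log_le_log (by norm_num) hW3)
    have hP : 1 ≤ Real.log (W ^ 200) := by
      rw [Real.log_pow]; push_cast; nlinarith
    have hQ0 : 0 < (L : ℝ) / W ^ 3 := by positivity
    have hQW : W ≤ (L : ℝ) / W ^ 3 := by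
      rw [le_div_iff₀ (by positivity)]
      calc W * W ^ 3 = W ^ 4 := by ring
        _ ≤ W ^ 203 := pow_le_pow_right₀ hW1 (by norm_num)
        _ ≤ L := hWL
    have hQ : 1 ≤ Real.log ((L : ℝ) / W ^ 3) :=
      hlogW.trans (Real.log_le_log hW0 hQW)
    have hQX₀ : (L : ℝ) / W ^ 3 ≤ Real.exp (Real.sqrt (Real.log (Real.sqrt X₃))) := by
      have h1 : (L : ℝ) / W ^ 3 ≤ L := div_le_self hL0.le (one_le_pow₀ hW1)
      refine h1.trans (hLexp.trans ?_)
      rw [Real.exp_le_exp, Real.log_sqrt (by linarith)]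
      exact Real.sqrt_le_sqrt (by linarith [Real.log_le_log (by linarith) hXX₃])
    have h := minorArc_typ_le (g := ⇑g) hg hg1 hP2 hP hQ0 hQ hQX₀ hd0 hL hq1 hcop hα2
      (X₃ := X₃)
    have hnum := minorArc_numerics hW3 hd hWq hqL hWL hX₃1 hLX₃
    refine h.trans (hnum.trans ?_)
    have hmid : 0 ≤ 1 / ((d : ℝ) * W ^ (1 / 4 : ℝ)) := by positivity
    have h1 : 212 * (L : ℝ) * X₃ * ((1 + Real.log L) / Real.sqrt (d * W) + 1 / W ^ 2) ≤
        212 * (L : ℝ) * X₃ * (1 / W ^ 2 + 1 / (d * W ^ (1 / 4 : ℝ)) +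
          (1 + Real.log L) / Real.sqrt (d * W)) :=
      mul_le_mul_of_nonneg_left (by linarith) (by positivity)
    refine h1.trans ?_
    apply mul_le_mul_of_nonneg_right _ (by positivity)
    apply mul_le_mul_of_nonneg_right _ (by positivity)
    exact mul_le_mul_of_nonneg_right (by linarith) (by positivity)

end MRT2015

end Literature.NumberTheory.LFunctions

end
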